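import Literature.MathematicalPhysics.StatisticalMechanics.Theil2006DiscreteImbedding
import HarnessLib

/-!
# Theil 2006, Appendix Proposition 4.8 (1): uniqueness of the reference configuration up to a
rigid motion of `A₂` ((60)) on ball patches — proof

Topic `Literature/MathematicalPhysics/StatisticalMechanics`; companion of `Theil2006.lean`
(F. Theil, *A proof of crystallization in two dimensions*, Comm. Math. Phys. **262** (2006)
209–236, accepted preprint of 26 Aug 2005, lit store `paper:url-69bff4ce1e30`), Appendix §4.2,
Proposition 4.8 (p. 21) assertion (1), and Lemma 4.7 (p. 20). PROVED, from the tree's Lemma 4.7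
(`Theil2006DiscreteImbedding.lean`: `exists_isHexagonalNbhd`, `IsHexagonalNbhd.apply_rim_eq`).

## Source, as printed (preprint pp. 21, 23)

Proposition 4.8: "… there exists a discrete imbedding `Φ : ω → A₂`, where `ω = y⁻¹(Ω′)`.
Furthermore, the following assertions are true. (1) `Φ` is unique up to rotation and translation,
i.e. for each discrete imbedding `Φ′ : ω → A₂`, there exists a rotation matrix `R ∈ SO(2)` such
that (60) `Φ′(x) − Φ′(x′) = R(Φ(x) − Φ(x′))` for all `x, x′ ∈ ω`." Proof (p. 23): "The uniqueness up
to rotations and translation can be seen as follows: Let `x₀, x₀′ ∈ ω` be two starting points,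
then by Lemma 4.7 `φ₀` and `φ₀′` differ only by a translation and a rotation."

## What is proved

`Theil2006.discreteImbedding_unique_ball`: under (13) with `0 < α ≤ 1/200`, for an open ball
`Ω′ = B(c, r)` of radius `r ≥ 2` such that no defect lies in `B(c, r + 2)`, ANY TWO discrete
imbeddings `φ, ψ` of `ω = y⁻¹(Ω′)` (Definition 2.4) satisfy (60): there is `k` with
`ψ(x) − ψ(x′) = R^k_{π/3}(φ(x) − φ(x′))` for all `x, x′ ∈ ω`, stated with the plane rotation
`Theil2006.rotPow k : ℝ² ≃ₗᵢ ℝ²` (so in the form of (60) used by `Theil2006.IsReferenceOn.unique`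
of `Theil2006LocalGeometryFromReference.lean`). The lower bound `r ≥ 2` is necessary (for
`Ω′ = B(y(x), 1)` capturing a particle and two opposite neighbours only, (60) fails; LIT1 §34,
print flag F4); the print has none.

Architecture (ours; the print's one sentence invokes Lemma 4.7 along paths):
* the best-aligned neighbour (`IsHexagonalNbhd.exists_ip_ge`): at a particle with a hexagonal
  neighbourhood, for every direction some neighbour makes an angle with cosine `≥ 4/5` with it —
  from the near-equilateral triangles of the wheel (sides in `[1−α, 1+α]`, positive orientation),
  by an inner-product computation (`align_core`);
* hence (`IsHexagonalNbhd.exists_dist_sq_le`) a neighbour strictly closer to any point at distance `≥ 7/10`,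
  the exclusion radius (`isShortRange_of_dist_le`: a particle within `3/2` of a hexagonal centre is
  one of its six neighbours), and an apex of the inward bond that is also strictly closer once the
  distance is `≥ 3/2` (`apex_core`);
* a triangle of `𝒮`-bonds inside the patch is mapped by every discrete imbedding to a positively
  oriented unit lattice triangle (`IsDiscreteImbeddingOn.sub_eq_rot60_of_det_pos`, Remark 2.5 +
  (20), as in the tree's `IsHexagonalNbhd.sub_eq_rot60_of_discreteImbedding`);
* induction over the particles of `ω` by the number of particles closer to `c`: the rigid motion
  read off at a particle within `7/10` of `c` (whole wheel inside `Ω′`) propagates outward through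
  wheels (inner layer) and triangles (outer layer).
-/

noncomputable section

namespace Literature.MathematicalPhysics.StatisticalMechanics

namespace Theil2006

open Metric

/-! ### Lattice rotations (labels) -/

/-- `rot60` is additive. [folklore] -/
private theorem rot60_add_eq (a b : ℤ × ℤ) : rot60 (a + b) = rot60 a + rot60 b := by
  simp only [rot60, Prod.fst_add, Prod.snd_add, Prod.mk_add_mk, Prod.mk.injEq]
  constructor <;> ring

/-- Iterates of `rot60` are additive. [folklore] -/
private theorem rot60_iterate_add_eq (n : ℕ) (a b : ℤ × ℤ) :
    rot60^[n] (a + b) = rot60^[n] a + rot60^[n] b := by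
  induction n with
  | zero => rfl
  | succ n ih => rw [Function.iterate_succ_apply', Function.iterate_succ_apply',
      Function.iterate_succ_apply', ih, rot60_add_eq]

/-- Iterates of `rot60` commute with subtraction. [folklore] -/
private theorem rot60_iterate_sub_eq (n : ℕ) (a b : ℤ × ℤ) :
    rot60^[n] (a - b) = rot60^[n] a - rot60^[n] b := by
  rw [eq_sub_iff_add_eq, ← rot60_iterate_add_eq, sub_add_cancel]

/-- Iterates of `rot60` commute with each other. [folklore] -/
private theorem rot60_iterate_comm (m n : ℕ) (v : ℤ × ℤ) : rot60^[m] (rot60^[n] v) = rot60^[n] (rot60^[m] v) := by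
  rw [← Function.iterate_add_apply, ← Function.iterate_add_apply, add_comm]

/-- `rot60³ = −id`. [folklore] -/
private theorem rot60_iterate_three_eq (k : ℤ × ℤ) : rot60^[3] k = -k := by
  ext <;>
    simp only [Function.iterate_succ, Function.iterate_zero, Function.comp_apply, id_eq, rot60,
      Prod.fst_neg, Prod.snd_neg] <;> ring

/-- `rot60⁶ = id`. [folklore] -/
private theorem rot60_iterate_six_eq (k : ℤ × ℤ) : rot60^[6] k = k := by
  rw [show (6 : ℕ) = 3 + 3 from rfl, Function.iterate_add_apply, rot60_iterate_three_eq,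
    rot60_iterate_three_eq, neg_neg]

/-- Any two unit vectors of `A₂` differ by a power of the `π/3` rotation. [folklore] -/
private theorem exists_iterate_rot60_eq {u u' : ℤ × ℤ} (hu : u ∈ unitShell) (hu' : u' ∈ unitShell) :
    ∃ n : ℕ, u' = rot60^[n] u := by
  have key : ∀ v ∈ unitShell, ∃ i : ℕ, i < 6 ∧ v = rot60^[i] (1, 0) := by
    intro v hv
    simp only [unitShell, Finset.mem_insert, Finset.mem_singleton] at hv
    rcases hv with rfl | rfl | rfl | rfl | rfl | rfl
    · exact ⟨0, by norm_num, by decide⟩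
    · exact ⟨1, by norm_num, by decide⟩
    · exact ⟨3, by norm_num, by decide⟩
    · exact ⟨4, by norm_num, by decide⟩
    · exact ⟨5, by norm_num, by decide⟩
    · exact ⟨2, by norm_num, by decide⟩
  obtain ⟨i, hi, rfl⟩ := key u hu
  obtain ⟨j, -, rfl⟩ := key u' hu'
  refine ⟨j + (6 - i), ?_⟩
  rw [← Function.iterate_add_apply, show j + (6 - i) + i = j + 6 by omega,
    Function.iterate_add_apply, rot60_iterate_six_eq]

/-- The norm form is `1` on the unit shell. [folklore] -/
private theorem normForm_eq_one_of_mem_unitShell' {v : ℤ × ℤ} (hv : v ∈ unitShell) :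
    v.1 ^ 2 + v.1 * v.2 + v.2 ^ 2 = 1 := by
  simp only [unitShell, Finset.mem_insert, Finset.mem_singleton] at hv
  rcases hv with rfl | rfl | rfl | rfl | rfl | rfl <;> norm_num

/-- `cross(k, R⁵ k) = −|k|²`: a vector and its `−π/3`-rotate are negatively oriented. [folklore] -/
private theorem cross_rot60_iterate_five_eq (k : ℤ × ℤ) :
    k.1 * (rot60^[5] k).2 - k.2 * (rot60^[5] k).1 = -(k.1 ^ 2 + k.1 * k.2 + k.2 ^ 2) := by
  simp only [Function.iterate_succ, Function.iterate_zero, Function.comp_apply, id_eq, rot60]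
  ring

/-! ### The plane rotation by `π/3` and its powers -/

/-- The rotation of `ℝ²` by `π/3`, as a linear map. [folklore] -/
def rot60Lin : Plane →ₗ[ℝ] Plane where
  toFun v := !₂[1 / 2 * v 0 - √3 / 2 * v 1, √3 / 2 * v 0 + 1 / 2 * v 1]
  map_add' v w := by
    ext i; fin_cases i <;> simp <;> ring
  map_smul' c v := by
    ext i; fin_cases i <;> simp <;> ring

/-- First coordinate of the rotated vector. [folklore] -/
@[simp] private theorem rot60Lin_apply_zero (v : Plane) : rot60Lin v 0 = 1 / 2 * v 0 - √3 / 2 * v 1 := by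
  simp [rot60Lin]

/-- Second coordinate of the rotated vector. [folklore] -/
@[simp] private theorem rot60Lin_apply_one (v : Plane) : rot60Lin v 1 = √3 / 2 * v 0 + 1 / 2 * v 1 := by
  simp [rot60Lin]

/-- `‖v‖² = v₀² + v₁²` in `ℝ²`. [folklore] -/
private theorem norm_sq_coords (v : Plane) : ‖v‖ ^ 2 = v 0 ^ 2 + v 1 ^ 2 := by
  rw [EuclideanSpace.norm_sq_eq, Fin.sum_univ_two, Real.norm_eq_abs, Real.norm_eq_abs, sq_abs,
    sq_abs]

/-- The rotation preserves norms. [folklore] -/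
private theorem norm_rot60Lin (v : Plane) : ‖rot60Lin v‖ = ‖v‖ := by
  have h3 : (√3 : ℝ) ^ 2 = 3 := Real.sq_sqrt (by norm_num)
  have key : ‖rot60Lin v‖ ^ 2 = ‖v‖ ^ 2 := by
    rw [norm_sq_coords, norm_sq_coords, rot60Lin_apply_zero, rot60Lin_apply_one]
    linear_combination (1 / 4 * (v 0) ^ 2 + 1 / 4 * (v 1) ^ 2) * h3
  have h1 := norm_nonneg (rot60Lin v)
  have h2 := norm_nonneg v
  nlinarith [key]

/-- **The rotation `R_{π/3} ∈ SO(2)` of `ℝ²`** (the matrix of the proof of Lemma 4.6, p. 20), as a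
linear isometry equivalence. [cite: Theil2006, §4.2 proof of Lemma 4.6 (preprint p. 20)] -/
def rot60Plane : Plane ≃ₗᵢ[ℝ] Plane :=
  (⟨rot60Lin, norm_rot60Lin⟩ : Plane →ₗᵢ[ℝ] Plane).toLinearIsometryEquiv rfl

/-- `rot60Plane` acts as `rot60Lin`. [folklore] -/
private theorem rot60Plane_apply (v : Plane) : rot60Plane v = rot60Lin v := rfl

/-- The plane rotation by `π/3` acts on `A₂` as `rot60` on labels. [cite: Theil2006, §4.2 proof of Lemma 4.6 (the rotation R_{π/3}, preprint p. 20); our lemma] -/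
theorem rot60Plane_triPoint (k : ℤ × ℤ) : rot60Plane (triPoint k) = triPoint (rot60 k) := by
  have h3 : (√3 : ℝ) ^ 2 = 3 := Real.sq_sqrt (by norm_num)
  ext i
  fin_cases i
  · simp [rot60Plane_apply, rot60]
    linear_combination (-(1 : ℝ) / 4 * (k.2 : ℝ)) * h3
  · simp [rot60Plane_apply, rot60]
    ring

/-- Powers of the `π/3` rotation, `R^n_{π/3}`. [cite: Theil2006, §4.2 proof of Lemma 4.6 (the rotation R_{π/3}, preprint p. 20); our lemma] -/
def rotPow : ℕ → (Plane ≃ₗᵢ[ℝ] Plane)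
  | 0 => LinearIsometryEquiv.refl ℝ Plane
  | n + 1 => (rotPow n).trans rot60Plane

/-- `R^n_{π/3}` acts on `A₂` as `rot60^[n]` on labels.
[cite: Theil2006, §4.2 proof of Lemma 4.6 (the rotation R_{π/3}, preprint p. 20); our lemma] -/
theorem rotPow_triPoint (n : ℕ) (k : ℤ × ℤ) : rotPow n (triPoint k) = triPoint (rot60^[n] k) := by
  induction n with
  | zero => rfl
  | succ n ih =>
    show rot60Plane (rotPow n (triPoint k)) = _
    rw [ih, rot60Plane_triPoint, Function.iterate_succ_apply']

/-! ### A triangle of `𝒮`-bonds under a discrete imbedding -/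

section Triangle

variable {X : Type*} {α : ℝ} {y : X → Plane} {ω : Set X} {φ : X → ℤ × ℤ}

/-- **A positively oriented `𝒮`-triangle goes to a positively oriented unit lattice triangle**
(Remark 2.5 + (20)): if `a, b, c ∈ ω` are pairwise `𝒮`-neighbours with
`det(y(b) − y(a), y(c) − y(a)) > 0` and `φ` is a discrete imbedding of `ω` (`α < 1`), then
`φ(c) − φ(a) = R_{π/3}(φ(b) − φ(a))`. [cite: Theil2006, §2.3 Definition 2.4 (20), Remark 2.5; §4.2 Lemma 4.7 (preprint pp. 7, 20)] -/
theorem IsDiscreteImbeddingOn.sub_eq_rot60_of_det_pos (hφ : IsDiscreteImbeddingOn α y ω φ)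
    (hα : α < 1) {a b c : X} (ha : a ∈ ω) (hb : b ∈ ω) (hc : c ∈ ω)
    (hab : IsShortRange α y a b) (hac : IsShortRange α y a c) (hbc : IsShortRange α y b c)
    (hdet : 0 < det₂ (y b - y a) (y c - y a)) : φ c - φ a = rot60 (φ b - φ a) := by
  have hu : φ b - φ a ∈ unitShell := hφ.sub_mem_unitShell hα ha hb hab
  have hu' : φ c - φ a ∈ unitShell := hφ.sub_mem_unitShell hα ha hc hac
  have hd : φ c - φ a - (φ b - φ a) ∈ unitShell := by
    rw [sub_sub_sub_cancel_right]
    exact hφ.sub_mem_unitShell hα hb hc hbc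
  rcases eq_rot60_or_eq_rot60_iterate_five hu hu' hd with h1 | h5
  · exact h1
  · exfalso
    have h20 := hφ.orientationOn ha hb hc hab hac hbc
    rw [← map_sub, ← map_sub, h5, det₂_triPoint] at h20
    have hcr : ((φ b - φ a).1 * (rot60^[5] (φ b - φ a)).2 -
        (φ b - φ a).2 * (rot60^[5] (φ b - φ a)).1 : ℤ) = -1 := by
      rw [cross_rot60_iterate_five_eq, normForm_eq_one_of_mem_unitShell' hu]
    rw [hcr] at h20
    have h3 : (0 : ℝ) < √3 := Real.sqrt_pos.2 (by norm_num)
    push_cast at h20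
    nlinarith

/-- `det` is invariant under cyclic relabelling of a triangle:
`det(c − b, a − b) = det(b − a, c − a)`. [folklore] -/
private theorem det₂_cyclic (A B C : Plane) : det₂ (C - B) (A - B) = det₂ (B - A) (C - A) := by
  unfold det₂
  simp only [PiLp.sub_apply]
  ring

end Triangle

/-! ### Plane vectors in coordinates -/

section Coordinates

/-- The coordinate inner product on `ℝ²` (kept elementary on purpose). [folklore] -/
def ip (u v : Plane) : ℝ := u 0 * v 0 + u 1 * v 1

/-- `‖u − v‖² = ‖u‖² − 2⟨u,v⟩ + ‖v‖²`. [folklore] -/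
private theorem norm_sub_sq_ip (u v : Plane) : ‖u - v‖ ^ 2 = ‖u‖ ^ 2 - 2 * ip u v + ‖v‖ ^ 2 := by
  rw [norm_sq_coords, norm_sq_coords, norm_sq_coords, ip]
  simp only [PiLp.sub_apply]
  ring

/-- Lagrange's identity `⟨u,v⟩² + det(u,v)² = ‖u‖² ‖v‖²`. [folklore] -/
private theorem ip_sq_add_det₂_sq (u v : Plane) : ip u v ^ 2 + det₂ u v ^ 2 = ‖u‖ ^ 2 * ‖v‖ ^ 2 := by
  rw [norm_sq_coords, norm_sq_coords, ip, det₂]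
  ring

/-- The frame identity `‖u‖² ⟨a, w⟩ = ⟨a, u⟩⟨u, w⟩ + det(u, a) det(u, w)` (expansion of `a` and
`w` in the orthogonal frame `u, u^⊥`). [folklore] -/
private theorem frame_identity (u a w : Plane) :
    ‖u‖ ^ 2 * ip a w = ip a u * ip u w + det₂ u a * det₂ u w := by
  rw [norm_sq_coords, ip, ip, ip, det₂, det₂]
  ring

/-- `⟨u, v⟩ = ⟨v, u⟩`. [folklore] -/
private theorem ip_comm (u v : Plane) : ip u v = ip v u := by
  unfold ip; ring

end Coordinates

/-! ### The two real-arithmetic cores -/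

section Core

/-- Squares of lengths in `[1−α, 1+α]`. [folklore] -/
private theorem sq_bounds_of_mem {α t : ℝ} (hα : 0 < α) (hα' : α ≤ 1 / 200) (ht : 1 - α ≤ t)
    (ht' : t ≤ 1 + α) : 39601 / 40000 ≤ t ^ 2 ∧ t ^ 2 ≤ 40401 / 40000 := by
  have h0 : 0 ≤ t := by linarith
  have h1 : (199 / 200 : ℝ) ≤ t := by linarith
  have h2 : t ≤ 201 / 200 := by linarith
  constructor <;> nlinarith

/-- The polarization quantity `P = ⟨a,u⟩` of a wheel triangle lies in `[97/200, 129/250]`.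
[folklore] -/
private theorem P_bounds {α ℓ ℓa m P : ℝ} (hα : 0 < α) (hα' : α ≤ 1 / 200)
    (hℓ : 1 - α ≤ ℓ) (hℓ' : ℓ ≤ 1 + α) (hℓa : 1 - α ≤ ℓa) (hℓa' : ℓa ≤ 1 + α)
    (hm : 1 - α ≤ m) (hm' : m ≤ 1 + α) (hP : 2 * P = ℓa ^ 2 + ℓ ^ 2 - m ^ 2) :
    97 / 200 ≤ P ∧ P ≤ 129 / 250 := by
  obtain ⟨h1, h1'⟩ := sq_bounds_of_mem hα hα' hℓ hℓ'
  obtain ⟨h2, h2'⟩ := sq_bounds_of_mem hα hα' hℓa hℓa'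
  obtain ⟨h3, h3'⟩ := sq_bounds_of_mem hα hα' hm hm'
  constructor <;> linarith

set_option maxHeartbeats 400000 in
/-- **Alignment core.** Numbers as in a wheel: `ℓ = |u|`, `ℓa = |a|`, `m = |a − u|` in
`[1−α, 1+α]` (`0 < α ≤ 1/200`), `P = ⟨a,u⟩` with `2P = ℓa² + ℓ² − m²`, `Q = det(u,a) > 0` with
`P² + Q² = ℓ² ℓa²`; a direction `w`, `W = |w| > 0`, `A = ⟨u,w⟩`, `D = det(u,w) ≥ 0` with
`A² + D² = ℓ² W²`; the frame identity `ℓ² ⟨a,w⟩ = P A + Q D`; and maximality `⟨a,w⟩ ≤ A`. Then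
`A ≥ (4/5) ℓ W`. [folklore] -/
private theorem align_core {α ℓ ℓa m P Q W A D Ia : ℝ} (hα : 0 < α) (hα' : α ≤ 1 / 200)
    (hℓ : 1 - α ≤ ℓ) (hℓ' : ℓ ≤ 1 + α) (hℓa : 1 - α ≤ ℓa) (hℓa' : ℓa ≤ 1 + α)
    (hm : 1 - α ≤ m) (hm' : m ≤ 1 + α) (hP : 2 * P = ℓa ^ 2 + ℓ ^ 2 - m ^ 2)
    (hQ : 0 < Q) (hPQ : P ^ 2 + Q ^ 2 = ℓ ^ 2 * ℓa ^ 2) (hW : 0 < W) (hD : 0 ≤ D)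
    (hAD : A ^ 2 + D ^ 2 = ℓ ^ 2 * W ^ 2) (hframe : ℓ ^ 2 * Ia = P * A + Q * D) (hmax : Ia ≤ A) :
    4 / 5 * (ℓ * W) ≤ A := by
  by_contra hlt
  rw [not_le] at hlt
  have hℓ0 : 0 < ℓ := by linarith
  obtain ⟨hl2, hl2'⟩ := sq_bounds_of_mem hα hα' hℓ hℓ'
  obtain ⟨hla2, -⟩ := sq_bounds_of_mem hα hα' hℓa hℓa'
  obtain ⟨hP1, hP2⟩ := P_bounds hα hα' hℓ hℓ' hℓa hℓa' hm hm' hP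
  -- bounds on ℓ² − P and Q²
  have hc1 : ℓ ^ 2 - P ≤ 263 / 500 := by linarith
  have hc0 : 0 < ℓ ^ 2 - P := by linarith
  have hprod : (39601 / 40000 : ℝ) * (39601 / 40000) ≤ ℓ ^ 2 * ℓa ^ 2 :=
    mul_le_mul hl2 hla2 (by norm_num) (by positivity)
  have hPsq : P ^ 2 ≤ (129 / 250) ^ 2 := pow_le_pow_left₀ (by linarith) hP2 2
  have hQ2 : 7 / 10 ≤ Q ^ 2 := by nlinarith
  -- (*) Q D ≤ (ℓ² − P) A, hence A ≥ 0
  have hIa : ℓ ^ 2 * Ia ≤ ℓ ^ 2 * A := mul_le_mul_of_nonneg_left hmax (sq_nonneg ℓ)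
  have hstar : Q * D ≤ (ℓ ^ 2 - P) * A := by nlinarith
  have hQD : 0 ≤ Q * D := mul_nonneg hQ.le hD
  have hA0 : 0 ≤ A := by
    by_contra hA
    rw [not_le] at hA
    have : (ℓ ^ 2 - P) * A < 0 := mul_neg_of_pos_of_neg hc0 hA
    linarith
  -- D² > (9/25) (ℓW)²
  have hℓW : 0 < ℓ * W := mul_pos hℓ0 hW
  have hX : 0 < (ℓ * W) ^ 2 := pow_pos hℓW 2
  have hA2 : A ^ 2 < 16 / 25 * (ℓ * W) ^ 2 := by
    have h := pow_lt_pow_left₀ hlt hA0 two_ne_zero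
    nlinarith
  have hD2 : 9 / 25 * (ℓ * W) ^ 2 < D ^ 2 := by nlinarith
  -- square (*)
  have hsq : (Q * D) ^ 2 ≤ ((ℓ ^ 2 - P) * A) ^ 2 := pow_le_pow_left₀ hQD hstar 2
  have hR : ((ℓ ^ 2 - P) * A) ^ 2 ≤ (263 / 500) ^ 2 * A ^ 2 := by
    rw [mul_pow]
    exact mul_le_mul_of_nonneg_right (pow_le_pow_left₀ hc0.le hc1 2) (sq_nonneg _)
  have hL : 7 / 10 * D ^ 2 ≤ (Q * D) ^ 2 := by
    rw [mul_pow]; exact mul_le_mul_of_nonneg_right hQ2 (sq_nonneg _)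
  have h1 : 7 / 10 * (9 / 25 * (ℓ * W) ^ 2) < 7 / 10 * D ^ 2 := by linarith
  have h2 : (263 / 500 : ℝ) ^ 2 * A ^ 2 ≤ (263 / 500) ^ 2 * (16 / 25 * (ℓ * W) ^ 2) :=
    mul_le_mul_of_nonneg_left hA2.le (by positivity)
  have h3 : (7 / 10 : ℝ) * (9 / 25) ≤ (263 / 500) ^ 2 * (16 / 25) := by
    by_contra h
    rw [not_le] at h
    nlinarith
  norm_num at h3

/-- **Apex core.** In the same notation, if `u` is well aligned (`A ≥ (4/5) ℓ W`) and the apex `a`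
lies on the side of `w` (`Q D ≥ 0`), then `⟨a, w⟩ ≥ (19/50) W`. [folklore] -/
private theorem apex_core {α ℓ ℓa m P Q W A D Ia : ℝ} (hα : 0 < α) (hα' : α ≤ 1 / 200)
    (hℓ : 1 - α ≤ ℓ) (hℓ' : ℓ ≤ 1 + α) (hℓa : 1 - α ≤ ℓa) (hℓa' : ℓa ≤ 1 + α)
    (hm : 1 - α ≤ m) (hm' : m ≤ 1 + α) (hP : 2 * P = ℓa ^ 2 + ℓ ^ 2 - m ^ 2)
    (hW : 0 < W) (hQD : 0 ≤ Q * D) (hA : 4 / 5 * (ℓ * W) ≤ A)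
    (hframe : ℓ ^ 2 * Ia = P * A + Q * D) : 19 / 50 * W ≤ Ia := by
  have hℓ0 : 0 < ℓ := by linarith
  obtain ⟨hP1, -⟩ := P_bounds hα hα' hℓ hℓ' hℓa hℓa' hm hm' hP
  have hA0 : 0 ≤ A := le_trans (by positivity) hA
  have h1 : P * A ≤ ℓ ^ 2 * Ia := by rw [hframe]; linarith
  have h2 : 97 / 200 * (4 / 5 * (ℓ * W)) ≤ P * A :=
    calc 97 / 200 * (4 / 5 * (ℓ * W)) ≤ 97 / 200 * A :=
          mul_le_mul_of_nonneg_left hA (by norm_num)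
      _ ≤ P * A := mul_le_mul_of_nonneg_right hP1 hA0
  -- ℓ (ℓ Ia) ≥ ℓ ((97/250) W), so ℓ Ia ≥ (97/250) W
  have h3 : 97 / 250 * W ≤ ℓ * Ia := by
    have h : ℓ * (97 / 250 * W) ≤ ℓ * (ℓ * Ia) := by nlinarith
    exact le_of_mul_le_mul_left h hℓ0
  have hIa0 : 0 ≤ Ia := by
    by_contra h
    rw [not_le] at h
    have : ℓ * Ia < 0 := mul_neg_of_pos_of_neg hℓ0 h
    linarith
  -- ℓ Ia ≤ (1 + α) Ia
  have h4 : ℓ * Ia ≤ (201 / 200) * Ia := by nlinarith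
  linarith

end Core

/-! ### The best-aligned neighbour of a hexagonal wheel -/

section Wheel

variable {X : Type*} {α : ℝ} {y : X → Plane} {x : X} {p : Fin 6 → X}

/-- Side lengths of the wheel: spokes. [cite: Theil2006, §4.2 Lemma 4.7 (preprint p. 20)] -/
theorem IsHexagonalNbhd.norm_spoke (h : IsHexagonalNbhd α y x p) (i : Fin 6) :
    1 - α ≤ ‖y (p i) - y x‖ ∧ ‖y (p i) - y x‖ ≤ 1 + α := by
  have h1 := (h.isShortRange_centre i).le_dist
  have h2 := (h.isShortRange_centre i).dist_le
  rw [dist_comm, dist_eq_norm] at h1 h2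
  exact ⟨h1, h2⟩

/-- Side lengths of the wheel: rim. [cite: Theil2006, §4.2 Lemma 4.7 (preprint p. 20)] -/
theorem IsHexagonalNbhd.norm_rim (h : IsHexagonalNbhd α y x p) (i : Fin 6) :
    1 - α ≤ ‖(y (p (i + 1)) - y x) - (y (p i) - y x)‖ ∧
      ‖(y (p (i + 1)) - y x) - (y (p i) - y x)‖ ≤ 1 + α := by
  have h1 := (h.isShortRange_succ i).le_dist
  have h2 := (h.isShortRange_succ i).dist_le
  rw [dist_comm, dist_eq_norm] at h1 h2
  rw [sub_sub_sub_cancel_right]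
  exact ⟨h1, h2⟩

/-- `(i + 5) + 1 = i` in `Fin 6`. [folklore] -/
private theorem fin6_add_five_add_one' (i : Fin 6) : i + 5 + 1 = i := by
  have h : (5 : Fin 6) + 1 = 0 := by decide
  rw [add_assoc, h, add_zero]

/-- **The best-aligned neighbour.** At a particle `x` with a hexagonal neighbourhood
(`0 < α ≤ 1/200`), for every non-zero vector `w` some neighbour `p_i` satisfies
`⟨y(p_i) − y(x), w⟩ ≥ (4/5) |y(p_i) − y(x)| |w|` (the wheel's spokes are at most `≈ 73°` apart).
[cite: Theil2006, §4.2 Lemma 4.7 (preprint p. 20); our lemma] -/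
theorem IsHexagonalNbhd.exists_ip_ge (h : IsHexagonalNbhd α y x p) (hα : 0 < α)
    (hα' : α ≤ 1 / 200) {w : Plane} (hw : w ≠ 0) :
    ∃ i : Fin 6, 4 / 5 * (‖y (p i) - y x‖ * ‖w‖) ≤ ip (y (p i) - y x) w := by
  classical
  -- the neighbour maximizing ⟨u_i, w⟩
  obtain ⟨i, -, hi⟩ := Finset.exists_max_image Finset.univ (fun j => ip (y (p j) - y x) w)
    Finset.univ_nonempty
  refine ⟨i, ?_⟩
  set u : Plane := y (p i) - y x with hu
  have hW : 0 < ‖w‖ := norm_pos_iff.2 hw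
  obtain ⟨hℓ, hℓ'⟩ := h.norm_spoke i
  have hAD := ip_sq_add_det₂_sq u w
  by_cases hD : 0 ≤ det₂ u w
  · -- use the counter-clockwise successor
    set a : Plane := y (p (i + 1)) - y x with ha
    obtain ⟨hℓa, hℓa'⟩ := h.norm_spoke (i + 1)
    obtain ⟨hm, hm'⟩ := h.norm_rim i
    have hQ : 0 < det₂ u a := h.det_pos i
    have hPQ := ip_sq_add_det₂_sq u a
    have hframe := frame_identity u a w
    have hmax : ip a w ≤ ip u w := hi (i + 1) (Finset.mem_univ _)
    have hP : 2 * ip a u = ‖a‖ ^ 2 + ‖u‖ ^ 2 - ‖a - u‖ ^ 2 := by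
      rw [norm_sub_sq_ip a u]; ring
    rw [ip_comm u a] at hPQ
    exact align_core hα hα' hℓ hℓ' hℓa hℓa' hm hm' hP hQ hPQ hW hD hAD hframe hmax
  · -- use the clockwise predecessor, with the signs of both determinants flipped
    rw [not_le] at hD
    set a : Plane := y (p (i + 5)) - y x with ha
    obtain ⟨hℓa, hℓa'⟩ := h.norm_spoke (i + 5)
    have hrim := h.norm_rim (i + 5)
    rw [fin6_add_five_add_one'] at hrim
    obtain ⟨hm, hm'⟩ := hrim
    have hQ' : 0 < det₂ a u := by
      have := h.det_pos (i + 5)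
      rwa [fin6_add_five_add_one'] at this
    have hQ : 0 < -det₂ u a := by
      have e : det₂ a u = -det₂ u a := by unfold det₂; ring
      linarith
    have hPQ : ip a u ^ 2 + (-det₂ u a) ^ 2 = ‖u‖ ^ 2 * ‖a‖ ^ 2 := by
      rw [neg_sq, ip_comm a u]; exact ip_sq_add_det₂_sq u a
    have hframe : ‖u‖ ^ 2 * ip a w = ip a u * ip u w + (-det₂ u a) * (-det₂ u w) := by
      rw [neg_mul_neg]; exact frame_identity u a w
    have hmax : ip a w ≤ ip u w := hi (i + 5) (Finset.mem_univ _)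
    have hP : 2 * ip a u = ‖a‖ ^ 2 + ‖u‖ ^ 2 - ‖a - u‖ ^ 2 := by
      rw [norm_sub_sq_ip a u]; ring
    have hm2 : 1 - α ≤ ‖a - u‖ ∧ ‖a - u‖ ≤ 1 + α := by
      rw [← norm_neg, neg_sub]; exact ⟨hm, hm'⟩
    have hAD' : ip u w ^ 2 + (-det₂ u w) ^ 2 = ‖u‖ ^ 2 * ‖w‖ ^ 2 := by rw [neg_sq]; exact hAD
    exact align_core hα hα' hℓ hℓ' hℓa hℓa' hm2.1 hm2.2 hP hQ hPQ hW (by linarith) hAD' hframe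
      hmax

/-- **A neighbour strictly closer to a far point.** At a particle `x` with a hexagonal
neighbourhood, for every point `c` some neighbour `p_i` has
`|y(p_i) − c|² ≤ |y(x) − c|² − (8/5)(1−α)|y(x) − c| + (1+α)²` — strictly closer to `c` than
`y(x)` as soon as `|y(x) − c| ≥ 7/10`. [cite: Theil2006, §4.2 Lemma 4.7 (preprint p. 20); our lemma] -/
theorem IsHexagonalNbhd.exists_dist_sq_le (h : IsHexagonalNbhd α y x p) (hα : 0 < α)
    (hα' : α ≤ 1 / 200) (c : Plane) :
    ∃ i : Fin 6, 4 / 5 * (‖y (p i) - y x‖ * ‖c - y x‖) ≤ ip (y (p i) - y x) (c - y x) ∧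
      dist (y (p i)) c ^ 2 ≤
        dist (y x) c ^ 2 - 8 / 5 * (1 - α) * dist (y x) c + (1 + α) ^ 2 := by
  by_cases hc : c - y x = 0
  · have hc' : c = y x := sub_eq_zero.1 hc
    refine ⟨0, by rw [hc, norm_zero, mul_zero, mul_zero]; unfold ip; simp, ?_⟩
    obtain ⟨-, h1⟩ := h.norm_spoke 0
    rw [hc', dist_self, dist_eq_norm]
    nlinarith [norm_nonneg (y (p 0) - y x)]
  obtain ⟨i, hi⟩ := h.exists_ip_ge hα hα' hc
  refine ⟨i, hi, ?_⟩
  obtain ⟨hℓ, hℓ'⟩ := h.norm_spoke i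
  have hW : 0 ≤ ‖c - y x‖ := norm_nonneg _
  have e : dist (y (p i)) c ^ 2 =
      ‖y (p i) - y x‖ ^ 2 - 2 * ip (y (p i) - y x) (c - y x) + ‖c - y x‖ ^ 2 := by
    rw [dist_eq_norm, show y (p i) - c = (y (p i) - y x) - (c - y x) by abel, norm_sub_sq_ip]
  rw [e, dist_eq_norm, ← norm_neg (y x - c), neg_sub]
  have h1 : (1 - α) * ‖c - y x‖ ≤ ‖y (p i) - y x‖ * ‖c - y x‖ :=
    mul_le_mul_of_nonneg_right hℓ hW
  nlinarith

/-- **The exclusion radius.** Under (13), a particle `b ≠ x` within distance `3/2` of a particle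
`x` with a hexagonal neighbourhood is one of its six `𝒮`-neighbours (the neighbour best aligned
with `y(b) − y(x)` would otherwise be closer than `1 − α` to `y(b)`).
[cite: Theil2006, §2.2 (18) («elementary geometric considerations», preprint p. 7); our lemma] -/
theorem IsHexagonalNbhd.isShortRange_of_dist_le (h : IsHexagonalNbhd α y x p) (hα : 0 < α)
    (hα' : α ≤ 1 / 200) (hsep : ∀ a a' : X, a ≠ a' → 1 - α < dist (y a) (y a')) {b : X}
    (hbx : b ≠ x) (hb : dist (y b) (y x) ≤ 3 / 2) : IsShortRange α y x b := by
  obtain ⟨i, -, hi⟩ := h.exists_dist_sq_le hα hα' (y b)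
  have hs := hsep x b hbx.symm
  rw [dist_comm] at hb
  -- the bound is < (1 − α)² on (1 − α, 3/2]
  have hlt : dist (y (p i)) (y b) ^ 2 < (1 - α) ^ 2 := by nlinarith
  have heq : p i = b := by
    by_contra hne
    have := hsep (p i) b hne
    nlinarith [dist_nonneg (x := y (p i)) (y := y b)]
  rw [← heq]
  exact h.isShortRange_centre i

/-- **An apex of the inward bond is well inside.** With `p_i` the best-aligned neighbour towards
`c` (cosine `≥ 4/5`), one of the two apices `p_{i±1}` of the bond `{x, p_i}` satisfies
`|y(p_{i±1}) − c|² ≤ |y(x) − c|² − (19/25)|y(x) − c| + (1+α)²`.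
[cite: Theil2006, §4.2 Lemma 4.7 (preprint p. 20); our lemma] -/
theorem IsHexagonalNbhd.exists_apex_dist_sq_le (h : IsHexagonalNbhd α y x p) (hα : 0 < α)
    (hα' : α ≤ 1 / 200) {c : Plane} {i : Fin 6}
    (hi : 4 / 5 * (‖y (p i) - y x‖ * ‖c - y x‖) ≤ ip (y (p i) - y x) (c - y x))
    (hc : c ≠ y x) :
    ∃ j : Fin 6, (j = i + 1 ∨ j = i + 5) ∧
      dist (y (p j)) c ^ 2 ≤ dist (y x) c ^ 2 - 19 / 25 * dist (y x) c + (1 + α) ^ 2 := by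
  set u : Plane := y (p i) - y x with hu
  set w : Plane := c - y x with hw
  have hW : 0 < ‖w‖ := norm_pos_iff.2 (sub_ne_zero.2 hc)
  obtain ⟨hℓ, hℓ'⟩ := h.norm_spoke i
  have key : ∀ j : Fin 6, 19 / 50 * ‖w‖ ≤ ip (y (p j) - y x) w →
      dist (y (p j)) c ^ 2 ≤ dist (y x) c ^ 2 - 19 / 25 * dist (y x) c + (1 + α) ^ 2 := by
    intro j hj
    obtain ⟨-, hℓj⟩ := h.norm_spoke j
    have e : dist (y (p j)) c ^ 2 =
        ‖y (p j) - y x‖ ^ 2 - 2 * ip (y (p j) - y x) w + ‖w‖ ^ 2 := by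
      rw [dist_eq_norm, show y (p j) - c = (y (p j) - y x) - (c - y x) by abel, norm_sub_sq_ip]
    rw [e, dist_eq_norm, ← norm_neg (y x - c), neg_sub]
    nlinarith [norm_nonneg (y (p j) - y x)]
  by_cases hD : 0 ≤ det₂ u w
  · refine ⟨i + 1, Or.inl rfl, key _ ?_⟩
    set a : Plane := y (p (i + 1)) - y x with ha
    obtain ⟨hℓa, hℓa'⟩ := h.norm_spoke (i + 1)
    obtain ⟨hm, hm'⟩ := h.norm_rim i
    have hQ : 0 < det₂ u a := h.det_pos i
    have hP : 2 * ip a u = ‖a‖ ^ 2 + ‖u‖ ^ 2 - ‖a - u‖ ^ 2 := by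
      rw [norm_sub_sq_ip a u]; ring
    exact apex_core hα hα' hℓ hℓ' hℓa hℓa' hm hm' hP hW (mul_nonneg hQ.le hD) hi
      (frame_identity u a w)
  · rw [not_le] at hD
    refine ⟨i + 5, Or.inr rfl, key _ ?_⟩
    set a : Plane := y (p (i + 5)) - y x with ha
    obtain ⟨hℓa, hℓa'⟩ := h.norm_spoke (i + 5)
    have hrim := h.norm_rim (i + 5)
    rw [fin6_add_five_add_one'] at hrim
    obtain ⟨hm, hm'⟩ := hrim
    have hQ' : 0 < det₂ a u := by
      have := h.det_pos (i + 5)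
      rwa [fin6_add_five_add_one'] at this
    have hQ : det₂ u a < 0 := by
      have e : det₂ a u = -det₂ u a := by unfold det₂; ring
      linarith
    have hP : 2 * ip a u = ‖a‖ ^ 2 + ‖u‖ ^ 2 - ‖a - u‖ ^ 2 := by
      rw [norm_sub_sq_ip a u]; ring
    have hm2 : 1 - α ≤ ‖a - u‖ ∧ ‖a - u‖ ≤ 1 + α := by
      rw [← norm_neg, neg_sub]; exact ⟨hm, hm'⟩
    exact apex_core hα hα' hℓ hℓ' hℓa hℓa' hm2.1 hm2.2 hP hW
      (le_of_lt (mul_pos_of_neg_of_neg hQ hD)) hi (frame_identity u a w)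

end Wheel

/-! ### Propagation of a rigid motion through wheels and triangles -/

section Propagate

variable {X : Type*} {α : ℝ} {y : X → Plane} {ω : Set X} {φ ψ : X → ℤ × ℤ} {k : ℕ} {t : ℤ × ℤ}

/-- **Through a wheel.** If `ψ = t + R^k φ` at the centre `x` and at the rim particle `p₀` of a
hexagonal neighbourhood contained in the patch, then on the whole rim (Lemma 4.7, uniqueness:
both imbeddings are the hexagon walk). [cite: Theil2006, §4.2 Lemma 4.7 (preprint p. 20)] -/
theorem IsHexagonalNbhd.propagate {x : X} {p : Fin 6 → X} (h : IsHexagonalNbhd α y x p)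
    (hα : α < 1) (hω : nbhdSet α y x ⊆ ω) (hφ : IsDiscreteImbeddingOn α y ω φ)
    (hψ : IsDiscreteImbeddingOn α y ω ψ) (hx : ψ x = t + rot60^[k] (φ x))
    (h0 : ψ (p 0) = t + rot60^[k] (φ (p 0))) (j : Fin 6) :
    ψ (p j) = t + rot60^[k] (φ (p j)) := by
  have eφ := h.apply_rim_eq hα (hφ.mono hω) j
  have eψ := h.apply_rim_eq hα (hψ.mono hω) j
  simp only [hexWalk] at eφ eψ
  have hd : ψ (p 0) - ψ x = rot60^[k] (φ (p 0) - φ x) := by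
    rw [h0, hx, rot60_iterate_sub_eq]; abel
  rw [eψ, hd, rot60_iterate_comm, eφ, rot60_iterate_add_eq, hx]
  abel

/-- **Through a triangle.** If `a, b, v ∈ ω` are pairwise `𝒮`-neighbours with
`det(y(b) − y(a), y(v) − y(a)) > 0` and `ψ = t + R^k φ` at `a` and `b`, then also at `v` (both
imbeddings send the triangle to `φ(a), φ(b), φ(a) + R_{π/3}(φ(b) − φ(a))`).
[cite: Theil2006, §2.3 Definition 2.4 (20), Remark 2.5 (preprint p. 7)] -/
theorem IsDiscreteImbeddingOn.propagate_triangle (hφ : IsDiscreteImbeddingOn α y ω φ)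
    (hψ : IsDiscreteImbeddingOn α y ω ψ) (hα : α < 1) {a b v : X} (ha : a ∈ ω) (hb : b ∈ ω)
    (hv : v ∈ ω) (hab : IsShortRange α y a b) (hav : IsShortRange α y a v)
    (hbv : IsShortRange α y b v) (hdet : 0 < det₂ (y b - y a) (y v - y a))
    (hPa : ψ a = t + rot60^[k] (φ a)) (hPb : ψ b = t + rot60^[k] (φ b)) :
    ψ v = t + rot60^[k] (φ v) := by
  have eφ := hφ.sub_eq_rot60_of_det_pos hα ha hb hv hab hav hbv hdet
  have eψ := hψ.sub_eq_rot60_of_det_pos hα ha hb hv hab hav hbv hdet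
  have hd : ψ b - ψ a = rot60^[k] (φ b - φ a) := by
    rw [hPb, hPa, rot60_iterate_sub_eq]; abel
  rw [hd, ← Function.iterate_succ_apply' rot60, Function.iterate_succ_apply, ← eφ,
    rot60_iterate_sub_eq] at eψ
  rw [hPa] at eψ
  have := eq_add_of_sub_eq eψ
  rw [this]; abel

end Propagate

/-! ### (60) on ball patches -/

section Uniqueness

variable {α : ℝ} {N : ℕ} {y : Fin N → Plane}

/-- A particle of a ball patch sitting `2` inside the defect-free region has a hexagonal
neighbourhood, listed from any prescribed neighbour (Lemma 4.7).
[cite: Theil2006, §4.2 Lemma 4.7 (preprint p. 20)] -/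
theorem exists_hex_of_far_defects (hα : 0 < α) (hα' : α ≤ 1 / 200)
    (hsep : ∀ i j : Fin N, i ≠ j → 1 - α < dist (y i) (y j)) {c : Plane} {r : ℝ}
    (hdef : ∀ b ∈ defectSet α y, r + 2 ≤ dist (y b) c) {a w : Fin N} (ha : dist (y a) c < r)
    (hw : IsShortRange α y a w) : ∃ q : Fin 6 → Fin N, q 0 = w ∧ IsHexagonalNbhd α y a q := by
  have hα1 : α < 1 := by linarith
  have hx : a ∉ defectSet α y := fun h => by have := hdef a h; linarith
  have hN : ∀ ⦃b⦄, IsShortRange α y a b → b ∉ defectSet α y := by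
    intro b hb hbd
    have h1 := hdef b hbd
    have h2 := hb.dist_le
    have := dist_triangle (y b) (y a) c
    rw [dist_comm (y b) (y a)] at this
    linarith
  exact exists_isHexagonalNbhd hα hα' (fun x x' h => hsep x x' h) hx hN hw

/-- As `exists_hex_of_far_defects`, without prescribing the first rim particle.
[cite: Theil2006, §4.2 Lemma 4.7 (preprint p. 20)] -/
theorem exists_hex_of_far_defects' (hα : 0 < α) (hα' : α ≤ 1 / 200)
    (hsep : ∀ i j : Fin N, i ≠ j → 1 - α < dist (y i) (y j)) {c : Plane} {r : ℝ}
    (hdef : ∀ b ∈ defectSet α y, r + 2 ≤ dist (y b) c) {a : Fin N} (ha : dist (y a) c < r) :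
    ∃ q : Fin 6 → Fin N, IsHexagonalNbhd α y a q := by
  have hα1 : α < 1 := by linarith
  have hx : a ∉ defectSet α y := fun h => by have := hdef a h; linarith
  have h6 := ncard_neighbours_eq_six hα1 hx
  obtain ⟨w, hw⟩ := Set.nonempty_of_ncard_ne_zero (by rw [h6]; norm_num :
    ({x' | IsShortRange α y a x'} : Set (Fin N)).ncard ≠ 0)
  obtain ⟨q, -, hq⟩ := exists_hex_of_far_defects hα hα' hsep hdef ha hw
  exact ⟨q, hq⟩

/-- `s² − (8/5)(1−α) s + (1+α)² < s²` for `s ≥ 7/10`. [folklore] -/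
private theorem closer_of_bound {α s d : ℝ} (hα : 0 < α) (hα' : α ≤ 1 / 200) (hs : 7 / 10 ≤ s)
    (h : d ^ 2 ≤ s ^ 2 - 8 / 5 * (1 - α) * s + (1 + α) ^ 2) : d < s := by
  have h1 : d ^ 2 < s ^ 2 := by nlinarith
  exact lt_of_pow_lt_pow_left₀ 2 (by linarith) h1

/-- **Theil 2006, Proposition 4.8 (1) — (60) — for ball patches, proved.** Under (13) with
`0 < α ≤ 1/200`: if `Ω′ = B(c, r)` has radius `r ≥ 2` and no defect lies in `B(c, r + 2)`, then any
two discrete imbeddings `φ, ψ` of `ω = y⁻¹(Ω′)` differ by a rigid motion of `A₂`: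
`ψ(x) − ψ(x′) = R(φ(x) − φ(x′))` on `ω` for a rotation `R = R^k_{π/3} ∈ SO(2)`.
[cite: Theil2006, Appendix Proposition 4.8 (1) (60) (preprint p. 21) with proof p. 23 and Lemma 4.7 (p. 20); radius threshold ours (LIT1 §34)] -/
theorem discreteImbedding_unique_ball (hα : 0 < α) (hα' : α ≤ 1 / 200)
    (hsep : ∀ i j : Fin N, i ≠ j → 1 - α < dist (y i) (y j)) {c : Plane} {r : ℝ} (hr : 2 ≤ r)
    (hdef : ∀ b ∈ defectSet α y, r + 2 ≤ dist (y b) c) {φ ψ : Fin N → ℤ × ℤ}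
    (hφ : IsDiscreteImbeddingOn α y (y ⁻¹' ball c r) φ)
    (hψ : IsDiscreteImbeddingOn α y (y ⁻¹' ball c r) ψ) :
    ∃ k : ℕ, ∀ a b : Fin N, y a ∈ ball c r → y b ∈ ball c r →
      triPoint (ψ a) - triPoint (ψ b) = rotPow k (triPoint (φ a) - triPoint (φ b)) := by
  classical
  have hα1 : α < 1 := by linarith
  have hsep' : ∀ x x' : Fin N, x ≠ x' → 1 - α < dist (y x) (y x') := fun x x' h => hsep x x' h
  by_cases hne : ∃ a : Fin N, y a ∈ ball c r
  swap
  · exact ⟨0, fun a b ha _ => absurd ⟨a, ha⟩ hne⟩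
  -- Step 1: a particle within 7/10 of the centre
  set S := Finset.univ.filter fun a : Fin N => dist (y a) c < r with hS
  have hSne : S.Nonempty := by
    obtain ⟨a, ha⟩ := hne
    exact ⟨a, Finset.mem_filter.2 ⟨Finset.mem_univ _, mem_ball.1 ha⟩⟩
  obtain ⟨x₀, hx₀S, hmin⟩ := Finset.exists_min_image S (fun a => dist (y a) c) hSne
  have hx₀r : dist (y x₀) c < r := (Finset.mem_filter.1 hx₀S).2
  obtain ⟨p, hp⟩ := exists_hex_of_far_defects' hα hα' hsep hdef hx₀r
  have hx₀7 : dist (y x₀) c < 7 / 10 := by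
    by_contra hge
    rw [not_lt] at hge
    obtain ⟨i, -, hi⟩ := hp.exists_dist_sq_le hα hα' c
    have hlt := closer_of_bound hα hα' hge hi
    have hmem : p i ∈ S := Finset.mem_filter.2 ⟨Finset.mem_univ _, by linarith⟩
    have := hmin (p i) hmem
    linarith
  -- Step 2: the rigid motion read off at x₀
  have hspoke : ∀ j, dist (y (p j)) (y x₀) ≤ 1 + α := fun j => by
    rw [dist_comm]; exact (hp.isShortRange_centre j).dist_le
  have hpball : ∀ j, y (p j) ∈ ball c r := fun j => by
    rw [mem_ball]
    have := dist_triangle (y (p j)) (y x₀) c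
    linarith [hspoke j]
  have hx₀ball : y x₀ ∈ ball c r := mem_ball.2 hx₀r
  have hNω : nbhdSet α y x₀ ⊆ y ⁻¹' ball c r := by
    intro b hb
    rw [hp.nbhdSet_eq] at hb
    rcases hb with rfl | ⟨j, rfl⟩
    · exact hx₀ball
    · exact hpball j
  have hu₀ : φ (p 0) - φ x₀ ∈ unitShell :=
    hφ.sub_mem_unitShell hα1 hx₀ball (hpball 0) (hp.isShortRange_centre 0)
  have hu₀' : ψ (p 0) - ψ x₀ ∈ unitShell :=
    hψ.sub_mem_unitShell hα1 hx₀ball (hpball 0) (hp.isShortRange_centre 0)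
  obtain ⟨k, hk⟩ := exists_iterate_rot60_eq hu₀ hu₀'
  set t : ℤ × ℤ := ψ x₀ - rot60^[k] (φ x₀) with ht
  have Px₀ : ψ x₀ = t + rot60^[k] (φ x₀) := by rw [ht]; abel
  have Pp0 : ψ (p 0) = t + rot60^[k] (φ (p 0)) := by
    have := eq_add_of_sub_eq hk
    rw [this, rot60_iterate_sub_eq, ht]; abel
  have Pp : ∀ j, ψ (p j) = t + rot60^[k] (φ (p j)) :=
    hp.propagate hα1 hNω hφ hψ Px₀ Pp0
  -- particles near the centre belong to the wheel of x₀
  have near : ∀ a : Fin N, dist (y a) c < 7 / 10 → ψ a = t + rot60^[k] (φ a) := by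
    intro a ha
    by_cases hax : a = x₀
    · rw [hax]; exact Px₀
    have hd : dist (y a) (y x₀) ≤ 3 / 2 := by
      have := dist_triangle (y a) c (y x₀)
      rw [dist_comm c (y x₀)] at this
      linarith
    obtain ⟨j, hj⟩ := hp.mem_range_of_isShortRange (hp.isShortRange_of_dist_le hα hα' hsep' hax hd)
    rw [← hj]; exact Pp j
  -- Step 3: induction on the number of particles closer to the centre
  set closer : Fin N → Finset (Fin N) :=
    fun a => Finset.univ.filter fun b => dist (y b) c < dist (y a) c with hcl
  have hcard : ∀ {a b : Fin N}, dist (y b) c < dist (y a) c → (closer b).card < (closer a).card := by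
    intro a b hab
    refine Finset.card_lt_card (Finset.ssubset_iff_of_subset (fun x hx => ?_) |>.2 ⟨b, ?_, ?_⟩)
    · exact Finset.mem_filter.2 ⟨Finset.mem_univ _, lt_trans (Finset.mem_filter.1 hx).2 hab⟩
    · exact Finset.mem_filter.2 ⟨Finset.mem_univ _, hab⟩
    · intro h
      exact lt_irrefl _ (Finset.mem_filter.1 h).2
  have main : ∀ (n : ℕ) (a : Fin N), (closer a).card ≤ n → y a ∈ ball c r →
      ψ a = t + rot60^[k] (φ a) := by
    intro n
    induction n with
    | zero =>
      intro a hn _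
      by_cases ha7 : dist (y a) c < 7 / 10
      · exact near a ha7
      · exfalso
        rw [not_lt] at ha7
        have : (closer a).card ≠ 0 := by
          rw [← Nat.pos_iff_ne_zero, Finset.card_pos]
          exact ⟨x₀, Finset.mem_filter.2 ⟨Finset.mem_univ _, by linarith⟩⟩
        omega
    | succ n ih =>
      intro a hn ha
      by_cases ha7 : dist (y a) c < 7 / 10
      · exact near a ha7
      rw [not_lt] at ha7
      have har : dist (y a) c < r := mem_ball.1 ha
      set s := dist (y a) c with hs
      -- induction hypothesis for strictly closer particles
      have IH : ∀ b : Fin N, dist (y b) c < s → ψ b = t + rot60^[k] (φ b) := fun b hb =>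
        ih b (by have := hcard hb; omega) (mem_ball.2 (by linarith))
      -- the wheel at a and its inward neighbour a₁
      obtain ⟨q, hq⟩ := exists_hex_of_far_defects' hα hα' hsep hdef har
      obtain ⟨i, hiip, hi⟩ := hq.exists_dist_sq_le hα hα' c
      have hd₁ : dist (y (q i)) c < s := closer_of_bound hα hα' ha7 hi
      have P₁ := IH (q i) hd₁
      have hq1ball : y (q i) ∈ ball c r := mem_ball.2 (by linarith)
      have hqspoke : ∀ j, dist (y (q j)) (y a) ≤ 1 + α := fun j => by
        rw [dist_comm]; exact (hq.isShortRange_centre j).dist_le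
      by_cases hin : dist (y (q i)) c < 99 / 100
      · -- inner layer: the wheel at a₁ lies in the patch; find a neighbour w of a₁ with P w
        have hw : ∃ w : Fin N, IsShortRange α y (q i) w ∧ ψ w = t + rot60^[k] (φ w) := by
          by_cases hin7 : dist (y (q i)) c < 7 / 10
          · by_cases hqx : q i = x₀
            · exact ⟨p 0, by rw [hqx]; exact hp.isShortRange_centre 0, Pp 0⟩
            · have hd : dist (y (q i)) (y x₀) ≤ 3 / 2 := by
                have := dist_triangle (y (q i)) c (y x₀)
                rw [dist_comm c (y x₀)] at this
                linarith
              exact ⟨x₀, (hp.isShortRange_of_dist_le hα hα' hsep' hqx hd).symm, Px₀⟩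
          · rw [not_lt] at hin7
            obtain ⟨q', hq'⟩ := exists_hex_of_far_defects' hα hα' hsep hdef (hd₁.trans har)
            obtain ⟨i', -, hi'⟩ := hq'.exists_dist_sq_le hα hα' c
            have hd₂ : dist (y (q' i')) c < dist (y (q i)) c :=
              closer_of_bound hα hα' hin7 hi'
            exact ⟨q' i', hq'.isShortRange_centre i', IH (q' i') (hd₂.trans hd₁)⟩
        obtain ⟨w, hw, Pw⟩ := hw
        obtain ⟨q₁, hq₁0, hq₁⟩ := exists_hex_of_far_defects hα hα' hsep hdef (hd₁.trans har) hw
        have hN₁ : nbhdSet α y (q i) ⊆ y ⁻¹' ball c r := by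
          intro b hb
          rw [hq₁.nbhdSet_eq] at hb
          rcases hb with rfl | ⟨j, rfl⟩
          · exact hq1ball
          · show y (q₁ j) ∈ ball c r
            rw [mem_ball]
            have h1 := (hq₁.isShortRange_centre j).dist_le
            rw [dist_comm] at h1
            have := dist_triangle (y (q₁ j)) (y (q i)) c
            linarith
        have Pw' : ψ (q₁ 0) = t + rot60^[k] (φ (q₁ 0)) := by rw [hq₁0]; exact Pw
        have Prim := hq₁.propagate hα1 hN₁ hφ hψ P₁ Pw'
        obtain ⟨j, hj⟩ := hq₁.mem_range_of_isShortRange (hq.isShortRange_centre i).symm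
        rw [← hj]; exact Prim j
      · -- outer layer: an apex of the bond {a, a₁} is strictly closer
        rw [not_lt] at hin
        have hs155 : 31 / 20 ≤ s := by
          by_contra hlt
          rw [not_le] at hlt
          have h1 : (99 / 100 : ℝ) ^ 2 ≤ dist (y (q i)) c ^ 2 := pow_le_pow_left₀ (by norm_num) hin 2
          nlinarith
        have hca : c ≠ y a := by
          intro h
          rw [h, dist_self] at hs
          linarith
        obtain ⟨j, hj, hja⟩ := hq.exists_apex_dist_sq_le hα hα' hiip hca
        have hd₂ : dist (y (q j)) c < s := by
          have h1 : dist (y (q j)) c ^ 2 < s ^ 2 := by nlinarith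
          exact lt_of_pow_lt_pow_left₀ 2 (by linarith) h1
        have P₂ := IH (q j) hd₂
        have hq2ball : y (q j) ∈ ball c r := mem_ball.2 (by linarith)
        rcases hj with rfl | rfl
        · -- triangle (a₁, a₂, a) with a₂ = q (i+1)
          have hdet : 0 < det₂ (y (q (i + 1)) - y (q i)) (y a - y (q i)) := by
            rw [det₂_cyclic]; exact hq.det_pos i
          exact hφ.propagate_triangle hψ hα1 hq1ball hq2ball ha (hq.isShortRange_succ i)
            (hq.isShortRange_centre i).symm (hq.isShortRange_centre (i + 1)).symm hdet P₁ P₂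
        · -- triangle (a₂, a₁, a) with a₂ = q (i+5)
          have hdet : 0 < det₂ (y (q i) - y (q (i + 5))) (y a - y (q (i + 5))) := by
            rw [det₂_cyclic]
            have := hq.det_pos (i + 5)
            rwa [fin6_add_five_add_one'] at this
          have hsucc : IsShortRange α y (q (i + 5)) (q i) := by
            have := hq.isShortRange_succ (i + 5)
            rwa [fin6_add_five_add_one'] at this
          exact hφ.propagate_triangle hψ hα1 hq2ball hq1ball ha hsucc
            (hq.isShortRange_centre (i + 5)).symm (hq.isShortRange_centre i).symm hdet P₂ P₁
  -- Step 4: the plane rotation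
  refine ⟨k, fun a b ha hb => ?_⟩
  have Pa := main _ a le_rfl ha
  have Pb := main _ b le_rfl hb
  rw [← map_sub, ← map_sub, Pa, Pb, rotPow_triPoint]
  congr 1
  rw [rot60_iterate_sub_eq]; abel

/-- **(60) in the form used by `Theil2006.IsReferenceOn.unique`** (a linear isometry of `ℝ²`
relating the two imbeddings on differences).
[cite: Theil2006, Appendix Proposition 4.8 (1) (60) (preprint p. 21)] -/
theorem discreteImbedding_unique_ball' (hα : 0 < α) (hα' : α ≤ 1 / 200)
    (hsep : ∀ i j : Fin N, i ≠ j → 1 - α < dist (y i) (y j)) {c : Plane} {r : ℝ} (hr : 2 ≤ r)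
    (hdef : ∀ b ∈ defectSet α y, r + 2 ≤ dist (y b) c) {φ ψ : Fin N → ℤ × ℤ}
    (hφ : IsDiscreteImbeddingOn α y (y ⁻¹' ball c r) φ)
    (hψ : IsDiscreteImbeddingOn α y (y ⁻¹' ball c r) ψ) :
    ∃ Rot : Plane ≃ₗᵢ[ℝ] Plane, ∀ a b : Fin N, y a ∈ ball c r → y b ∈ ball c r →
      triPoint (ψ a) - triPoint (ψ b) = Rot (triPoint (φ a) - triPoint (φ b)) := by
  obtain ⟨k, hk⟩ := discreteImbedding_unique_ball hα hα' hsep hr hdef hφ hψ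
  exact ⟨rotPow k, hk⟩

end Uniqueness

end Theil2006

end Literature.MathematicalPhysics.StatisticalMechanics

end
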